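import Mathlib
import Literature.Combinatorics.Optimization.PsdRankLowerBoundsUnconditional
import Literature.Combinatorics.Optimization.SosPseudoDensityDuality
import Literature.Combinatorics.Optimization.PseudoDensityFourier
import Literature.Combinatorics.Optimization.PsdRankBasicProperties
import HarnessLib

/-!
# Lee–Raghavendra–Steurer 2015, Theorem 1.8 ("Sum-of-squares degree vs. psd rank") — TYPED VERBATIM AND PROVED

Source: J. R. Lee, P. Raghavendra, D. Steurer, *Lower bounds on the size of semidefinite programming
relaxations*, STOC 2015 [LeeRaghavendraSteurer2015]; held text `paper:arxiv-1411.6317` (§1.3 "Main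
theorem", p. 7 read first-hand 2026-08-28; locators "p. N" = pages of that rendering, as in
`SDPRelaxationsMaxCSP.lean` / `PatternMatrixPsdRank.lean`).

Printed statements (verbatim up to notation):

* §1.3 (p. 7): "We say that `f` has a sum-of-squares (sos) certificate of degree `d` if there exist
  functions `g_1, …, g_k : {0,1}ⁿ → ℝ` such that `deg(g_1),…,deg(g_k) ≤ d/2`, and `f(x) = Σ_i g_i(x)²` for
  all `x ∈ {0,1}ⁿ`. … We then define the sos degree of `f`, denoted `deg_sos(f)`, to be the minimal `d`
  such that `f` has a degree-`d` sos certificate."  — certificates are the tree's `HasSosCertificate d f`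
  (`PatternMatrixPsdRank.lean`); the sos degree is `sosDegree f` below (an infimum over `ℕ`; attained for
  `f ≥ 0`, `hasSosCertificate_sosDegree`, since `f = (√f)²` is a degree-`2m` certificate).
* **Theorem 1.8** (Sum-of-squares degree vs. psd rank, p. 7 — "a representative theorem that embodies our
  approach"): "For every `m ≥ 1` and `f : {0,1}^m → ℝ_{≥0}`, there exists a constant `C > 0` such that the
  following holds. For `n ≥ 2m`, if `d + 2 = deg_sos(f)`, then
  `1 + n^{1+d/2} ≥ rk_psd(M_n^f) ≥ C (n / log n)^{d/4}`."  (`M_n^f(S,x) = f(x_S)`, the tree's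
  `patternMatrix n f`.)  — `LeeRaghavendraSteurer2015_thm18`, with "`rk_psd(M) ≤ X`" = `HasPsdFactorization M X`
  and "`rk_psd(M) ≥ Y`" = no psd factorization of size `r < Y` (the tree's reading throughout, e.g.
  `LeeRaghavendraSteurer2015_thm38`).  The upper bound is proved in the slightly STRONGER natural-number
  form `1 + n^{1 + ⌊d/2⌋}` (a degree-`(d+2)` certificate uses `g_i` of degree `≤ ⌊d/2⌋ + 1`); `log` is
  `Real.log` (the base only rescales `C`).

Proof.  UPPER bound (the remark behind "`rk_psd ≤ dim`", Prop. 1.13 (i), p. 8–9, for pattern matrices):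
a degree-`(d+2)` certificate `f = Σ_i g_i²` restricts along every `m`-subset `S` to
`f(x_S) = Σ_i g_i(x_S)²` with `x ↦ g_i(x_S)` of degree `≤ ⌊d/2⌋ + 1` on `{0,1}ⁿ`
(`HasDegreeLE.comp_coords`), so with the coordinates `q(x)` of point evaluation in a basis of the
degree-`≤ k` space (`evalCoords`, `SosPseudoDensityDuality.lean`) one has `M_n^f(S,x) = Tr(Λ_S q(x)q(x)ᵀ)`,
`Λ_S = Σ_i a_{S,i} a_{S,i}ᵀ ⪰ 0` (`HasSosCertificate.hasPsdFactorization_patternMatrix`), a psd factorization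
of size `dim = degDim n k ≤ Σ_{j ≤ k} binom(n,j) ≤ 1 + n^k` (`degDim_le_sum_choose`: the characters `χ_S`,
`|S| ≤ k`, span the degree-`≤ k` functions; `sum_range_choose_le_one_add_pow`).  LOWER bound: `d + 2 =
deg_sos(f)` gives `¬ HasSosCertificate d f`, hence (the §2 duality, `not_hasSosCertificate_iff_exists_pseudoDensity`,
PROVED in `SosPseudoDensityDuality.lean`) a degree-`d` pseudo-density `D` with `E[D f] < 0`; rescaling `f`
to `[0,1]` (psd rank is scale invariant) Theorem 3.8 (`LeeRaghavendraSteurer2015_thm38_holds`, PROVED in the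
tree) gives `rk_psd(M_n^f) ≥ (cεn/(d m² K log n))^{d/4} (ε/K)^{3/2} √(E f) = C · (n/log n)^{d/4}` for
`n ≥ 2m`, with `C = C(f) > 0`; for `d = 0` the bound `rk_psd ≥ C` is `rk_psd ≥ 1` (`M_n^f ≠ 0` as `f ≢ 0`,
`patternMatrix_apply_castLE`), `C = 1/2`.

One new notion with a body (`sosDegree`, LRS's `deg_sos`); no named facts; no instances, no notation;
standard axioms.  Label: literature formalization (row (5) of the literature-typing layer, cell
pnp-psdrank); no P-vs-NP content.
-/

noncomputable section

open Finset Matrix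
open scoped MatrixOrder
open Literature.Probability.RandomGraphs.LowDegree (walsh)
open Literature.Computability.Complexity.LowDegree (cubeFourierCoeff sum_cubeFourierCoeff_mul_walsh)

namespace Literature.Combinatorics.Optimization

variable {m : ℕ}

/-! ### The sos degree (§1.3) -/

/-- **The sos degree `deg_sos(f)`**: the minimal `d` such that `f` has a degree-`d` sos certificate
(`HasSosCertificate d f`); an infimum over `ℕ` (attained for `f ≥ 0`, `hasSosCertificate_sosDegree`).
[cite: LeeRaghavendraSteurer2015, §1.3 (p. 7: "the sos degree of f, denoted deg_sos(f)")] -/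
def sosDegree (f : (Fin m → Bool) → ℝ) : ℕ := sInf {d | HasSosCertificate d f}

/-- Every `f ≥ 0` on `{0,1}^m` has the degree-`2m` certificate `f = (√f)²`.
[cite: LeeRaghavendraSteurer2015, §1.3 (p. 7)] -/
theorem hasSosCertificate_of_nonneg {f : (Fin m → Bool) → ℝ} (hf : ∀ x, 0 ≤ f x) :
    HasSosCertificate (2 * m) f := by
  have h : HasDegreeLE (2 * m / 2) (fun x => Real.sqrt (f x)) := by
    rw [Nat.mul_div_cancel_left m two_pos]
    exact hasDegreeLE_of_cubeFourierCoeff_eq_zero fun S hS =>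
      absurd ((card_le_univ S).trans_eq (Fintype.card_fin m)) (not_le.2 hS)
  have h2 := h.hasSosCertificate_sq
  have hfeq : f = fun x => Real.sqrt (f x) ^ 2 := funext fun x => (Real.sq_sqrt (hf x)).symm
  rw [hfeq]
  exact h2

/-- `deg_sos(f)` is attained for `f ≥ 0`. [cite: LeeRaghavendraSteurer2015, §1.3 (p. 7)] -/
theorem hasSosCertificate_sosDegree {f : (Fin m → Bool) → ℝ} (hf : ∀ x, 0 ≤ f x) :
    HasSosCertificate (sosDegree f) f :=
  Nat.sInf_mem (s := {d | HasSosCertificate d f}) ⟨2 * m, hasSosCertificate_of_nonneg hf⟩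

/-- No certificate below `deg_sos(f)`. [cite: LeeRaghavendraSteurer2015, §1.3 (p. 7)] -/
theorem not_hasSosCertificate_of_lt_sosDegree {f : (Fin m → Bool) → ℝ} {d : ℕ}
    (h : d < sosDegree f) : ¬ HasSosCertificate d f :=
  Nat.notMem_of_lt_sInf h

/-! ### Restricting along a subset keeps the degree; the Gram factorization of `M_n^f` -/

/-- `x ↦ g(x ∘ e)` has degree `≤ k` whenever `g` has (substitute `X_j ↦ X_{e j}`).
[cite: LeeRaghavendraSteurer2015, §1.3 (p. 7: "M_n^f(S,x) = f(x_S)") with Prop. 1.13 (p. 8)] -/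
theorem HasDegreeLE.comp_coords {n k : ℕ} {g : (Fin m → Bool) → ℝ} (hg : HasDegreeLE k g)
    (e : Fin m → Fin n) : HasDegreeLE k (fun x : Fin n → Bool => g (fun j => x (e j))) := by
  obtain ⟨P, hP, hPg⟩ := hg
  refine ⟨MvPolynomial.rename e P, (MvPolynomial.totalDegree_rename_le _ _).trans hP, fun x => ?_⟩
  rw [MvPolynomial.eval_rename]
  have : (cubePoint x) ∘ e = cubePoint (fun j => x (e j)) := funext fun j => rfl
  rw [this]
  exact hPg _

/-- `Tr(a aᵀ · q qᵀ) = (a·q)²`. [cite: LeeRaghavendraSteurer2015, Prop. 1.13 proof (p. 8–9)] -/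
theorem trace_vecMulVec_self_mul_vecMulVec_self {r : ℕ} (a q : Fin r → ℝ) :
    (vecMulVec a a * vecMulVec q q).trace = (a ⬝ᵥ q) ^ 2 := by
  rw [vecMulVec_mul_vecMulVec, trace_vecMulVec, dotProduct_smul, smul_eq_mul, sq]

/-- **A degree-`d'` sos certificate of `f` gives a psd factorization of `M_n^f` of size
`dim {g : deg g ≤ d'/2}`** (Gram form `M_n^f(S,x) = Tr(Λ_S q(x)q(x)ᵀ)`).
[cite: LeeRaghavendraSteurer2015, Thm 1.8 upper bound (p. 7) with Prop. 1.13 (i) (p. 8–9)] -/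
theorem HasSosCertificate.hasPsdFactorization_patternMatrix {n d' : ℕ} {f : (Fin m → Bool) → ℝ}
    (hf : HasSosCertificate d' f) : HasPsdFactorization (patternMatrix n f) (degDim n (d' / 2)) := by
  classical
  obtain ⟨t, g, hg, hfx⟩ := hf
  have hcoord : ∀ (S : {S : Finset (Fin n) // S.card = m}) (i : Fin t),
      ∃ a : Fin (degDim n (d' / 2)) → ℝ,
        ∀ x, g i (fun j => x (S.1.orderEmbOfFin S.2 j)) = a ⬝ᵥ evalCoords n (d' / 2) x :=
    fun S i => ((hg i).comp_coords (fun j => S.1.orderEmbOfFin S.2 j)).exists_eq_dotProduct_evalCoords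
  choose a ha using hcoord
  refine ⟨fun S => ∑ i, vecMulVec (a S i) (a S i),
    fun x => vecMulVec (evalCoords n (d' / 2) x) (evalCoords n (d' / 2) x),
    fun S => posSemidef_sum _ fun i _ => ?_, fun x => ?_, fun S x => ?_⟩
  · simpa using posSemidef_vecMulVec_self_star (a S i)
  · simpa using posSemidef_vecMulVec_self_star (evalCoords n (d' / 2) x)
  · rw [Finset.sum_mul, trace_sum]
    simp_rw [trace_vecMulVec_self_mul_vecMulVec_self, ← ha]
    exact hfx _

/-- **`dim {g : {0,1}ⁿ → ℝ : deg g ≤ k} ≤ Σ_{j ≤ k} binom(n, j)`**: the characters `χ_S`, `|S| ≤ k`, span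
the degree-`≤ k` functions (Fourier inversion + vanishing above level `k`).
[cite: LeeRaghavendraSteurer2015, Thm 1.8 upper bound (p. 7: "1 + n^{1+d/2}")] -/
theorem degDim_le_sum_choose (n k : ℕ) : degDim n k ≤ ∑ j ∈ range (k + 1), n.choose j := by
  classical
  let ι := {S : Finset (Fin n) // S.card ≤ k}
  let v : ι → ((Fin n → Bool) → ℝ) := fun S => walsh S.1
  have hle : degreeLESubmodule n k ≤ Submodule.span ℝ (Set.range v) := by
    intro g hg
    rw [mem_degreeLESubmodule] at hg
    have hinv : g = ∑ S : Finset (Fin n), cubeFourierCoeff g S • (walsh S : (Fin n → Bool) → ℝ) := by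
      funext x
      simp only [Finset.sum_apply, Pi.smul_apply, smul_eq_mul]
      exact (sum_cubeFourierCoeff_mul_walsh g x).symm
    rw [hinv]
    refine Submodule.sum_mem _ fun S _ => ?_
    by_cases hS : S.card ≤ k
    · exact Submodule.smul_mem _ _ (Submodule.subset_span ⟨⟨S, hS⟩, rfl⟩)
    · rw [hg.cubeFourierCoeff_eq_zero (not_le.1 hS), zero_smul]
      exact Submodule.zero_mem _
  calc degDim n k ≤ Module.finrank ℝ (Submodule.span ℝ (Set.range v)) := Submodule.finrank_mono hle
    _ ≤ Fintype.card ι := finrank_range_le_card v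
    _ = ∑ j ∈ range (k + 1), n.choose j := by
      rw [Fintype.card_subtype, card_filter_card_le]

/-- The "trivial" direction of Theorem 1.8: `rk_psd(M_n^f) ≤ 1 + n^{⌊d'/2⌋}` for `f` with a degree-`d'`
certificate. [cite: LeeRaghavendraSteurer2015, Thm 1.8 (p. 7), upper bound] -/
theorem HasSosCertificate.hasPsdFactorization_patternMatrix_pow {n d' : ℕ} {f : (Fin m → Bool) → ℝ}
    (hf : HasSosCertificate d' f) : HasPsdFactorization (patternMatrix n f) (1 + n ^ (d' / 2)) :=
  hf.hasPsdFactorization_patternMatrix.mono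
    ((degDim_le_sum_choose n (d' / 2)).trans (sum_range_choose_le_one_add_pow n (d' / 2)))

/-! ### A nonzero entry of `M_n^f` (for the degenerate case `d = 0` of the lower bound) -/

/-- For `m ≤ n` every value `f(z)` occurs as an entry of `M_n^f` (row `S = {0,…,m−1}`, column an
extension of `z`). [cite: LeeRaghavendraSteurer2015, §1.3 (p. 7: "M_n^f(S,x) = f(x_S)")] -/
theorem exists_patternMatrix_eq {n : ℕ} (hmn : m ≤ n) (f : (Fin m → Bool) → ℝ) (z : Fin m → Bool) :
    ∃ (S : {S : Finset (Fin n) // S.card = m}) (x : Fin n → Bool), patternMatrix n f S x = f z := by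
  classical
  let e : Fin m ↪o Fin n := Fin.castLEOrderEmb hmn
  let S : Finset (Fin n) := univ.map e.toEmbedding
  have hS : S.card = m := by simp [S]
  refine ⟨⟨S, hS⟩, fun i => if h : (i : ℕ) < m then z ⟨i, h⟩ else false, ?_⟩
  have he : S.orderEmbOfFin hS = e :=
    (Finset.orderEmbOfFin_unique' hS (f := e) (fun j => by simp [S])).symm
  show f (fun j => _) = f z
  congr 1
  funext j
  have hej : ((S.orderEmbOfFin hS j : Fin n) : ℕ) = j := by
    rw [he]; simp [e, Fin.castLEOrderEmb]
  have hlt : ((S.orderEmbOfFin hS j : Fin n) : ℕ) < m := by rw [hej]; exact j.2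
  dsimp only
  rw [dif_pos hlt]
  congr 1
  exact Fin.ext hej

/-! ### Theorem 1.8 -/

/-- **Lee–Raghavendra–Steurer 2015, Theorem 1.8 (Sum-of-squares degree vs. psd rank) — PROVED.**
For every `m ≥ 1` and `f : {0,1}^m → ℝ_{≥0}` there is `C > 0` such that for all `n ≥ 2m`: if
`d + 2 = deg_sos(f)` then `1 + n^{1+d/2} ≥ rk_psd(M_n^f) ≥ C (n/log n)^{d/4}` — i.e. `M_n^f` has a psd
factorization of size `1 + n^{1 + ⌊d/2⌋}` and none of any size `r < C (n / log n)^{d/4}`.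
[cite: LeeRaghavendraSteurer2015, Thm 1.8 (p. 7)] -/
theorem LeeRaghavendraSteurer2015_thm18 :
    ∀ (m : ℕ), 1 ≤ m → ∀ f : (Fin m → Bool) → ℝ, (∀ x, 0 ≤ f x) →
      ∃ C : ℝ, 0 < C ∧ ∀ n : ℕ, 2 * m ≤ n → ∀ d : ℕ, d + 2 = sosDegree f →
        HasPsdFactorization (patternMatrix n f) (1 + n ^ (1 + d / 2)) ∧
        ∀ r : ℕ, (r : ℝ) < C * ((n : ℝ) / Real.log n) ^ ((d : ℝ) / 4) →
          ¬ HasPsdFactorization (patternMatrix n f) r := by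
  intro m hm f hf
  classical
  -- the upper bound, for every `n` and the `d` with `d + 2 = deg_sos(f)`
  have hupper : ∀ n d : ℕ, d + 2 = sosDegree f →
      HasPsdFactorization (patternMatrix n f) (1 + n ^ (1 + d / 2)) := by
    intro n d hd
    have h := (hasSosCertificate_sosDegree hf).hasPsdFactorization_patternMatrix_pow (n := n)
    rw [← hd, show (d + 2) / 2 = 1 + d / 2 by omega] at h
    exact h
  -- degenerate case: `deg_sos(f) < 2`, the hypothesis `d + 2 = deg_sos(f)` is never met
  by_cases h2 : sosDegree f < 2
  · exact ⟨1, one_pos, fun n _ d hd => absurd hd (by omega)⟩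
  push Not at h2
  set d₀ : ℕ := sosDegree f - 2 with hd₀
  have hd₀eq : d₀ + 2 = sosDegree f := by omega
  have hd_unique : ∀ d : ℕ, d + 2 = sosDegree f → d = d₀ := fun d hd => by omega
  -- `f ≢ 0` and its rescaling to `[0,1]`
  have hf_ne : ∃ z, f z ≠ 0 := by
    by_contra h0
    push Not at h0
    have hz : HasSosCertificate 0 f := by
      have : f = fun _ => (0 : ℝ) := funext h0
      rw [this]; exact HasSosCertificate.zero 0
    exact not_hasSosCertificate_of_lt_sosDegree (by omega) hz
  obtain ⟨z₀, hz₀⟩ := hf_ne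
  have hz₀pos : 0 < f z₀ := lt_of_le_of_ne (hf z₀) (Ne.symm hz₀)
  set Fmax : ℝ := univ.sup' univ_nonempty f with hFmax
  have hle_Fmax : ∀ z, f z ≤ Fmax := fun z => le_sup' f (mem_univ z)
  have hFmax_pos : 0 < Fmax := lt_of_lt_of_le hz₀pos (hle_Fmax z₀)
  obtain ⟨f₁, hf₁⟩ : ∃ f₁ : (Fin m → Bool) → ℝ, f₁ = fun z => Fmax⁻¹ * f z := ⟨_, rfl⟩
  have hf₁01 : ∀ z, 0 ≤ f₁ z ∧ f₁ z ≤ 1 := fun z => by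
    rw [hf₁]
    refine ⟨mul_nonneg (inv_nonneg.2 hFmax_pos.le) (hf z), ?_⟩
    rw [inv_mul_le_iff₀ hFmax_pos, mul_one]
    exact hle_Fmax z
  have hf₁pos : 0 < f₁ z₀ := by rw [hf₁]; exact mul_pos (inv_pos.2 hFmax_pos) hz₀pos
  have hEf₁ : 0 < cubeExpect f₁ := by
    unfold cubeExpect
    refine div_pos (lt_of_lt_of_le hf₁pos ?_) (by positivity)
    exact Finset.single_le_sum (fun z _ => (hf₁01 z).1) (mem_univ z₀)
  -- no degree-`d₀` certificate for `f₁`, hence a separating pseudo-density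
  have hnocert : ¬ HasSosCertificate d₀ f₁ := by
    intro h
    have h' := h.const_mul hFmax_pos.le
    have : (fun x => Fmax * f₁ x) = f := by
      funext x; rw [hf₁]; field_simp
    rw [this] at h'
    exact not_hasSosCertificate_of_lt_sosDegree (by omega) h'
  obtain ⟨D, hD, hDneg⟩ := (not_hasSosCertificate_iff_exists_pseudoDensity f₁).1 hnocert
  -- transfer of factorizations from `f` to `f₁`
  have htransfer : ∀ n r, HasPsdFactorization (patternMatrix n f) r →
      HasPsdFactorization (patternMatrix n f₁) r := by
    intro n r h
    have := h.const_mul (inv_nonneg.2 hFmax_pos.le) (a := Fmax⁻¹)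
    rw [hf₁]
    exact this
  -- Theorem 3.8
  obtain ⟨c, hc, h38⟩ := LeeRaghavendraSteurer2015_thm38_holds
  by_cases hd₀0 : d₀ = 0
  · -- `d = 0`: the bound `rk_psd ≥ C` with `C = 1/2` says `rk_psd ≥ 1`
    refine ⟨1 / 2, by norm_num, fun n hn d hd => ⟨hupper n d hd, fun r hr hfac => ?_⟩⟩
    have hdd : d = 0 := (hd_unique d hd).trans hd₀0
    subst hdd
    have hr0 : r = 0 := by
      have h1 : ((n : ℝ) / Real.log n) ^ (((0 : ℕ) : ℝ) / 4) = 1 := by simp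
      rw [h1, mul_one] at hr
      have : r < 1 := by exact_mod_cast (by linarith : (r : ℝ) < 1)
      omega
    subst hr0
    obtain ⟨S, x, hSx⟩ := exists_patternMatrix_eq (by omega : m ≤ n) f z₀
    have h0 := (hasPsdFactorization_zero_iff.1 hfac) S x
    rw [hSx] at h0
    exact hz₀ h0
  · -- `d ≥ 1`: Theorem 3.8 with the separating pseudo-density of degree `d₀`
    have hd₀1 : 1 ≤ d₀ := Nat.one_le_iff_ne_zero.2 hd₀0
    set e₀ : ℝ := -cubeExpect (fun x => D x * f₁ x) with he₀
    have he₀pos : 0 < e₀ := by rw [he₀]; linarith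
    set ε : ℝ := min 1 (e₀ / 2) with hε
    have hεpos : 0 < ε := lt_min one_pos (by positivity)
    have hε1 : ε ≤ 1 := min_le_left _ _
    have hDf : cubeExpect (fun x => D x * f₁ x) < -ε := by
      have : ε ≤ e₀ / 2 := min_le_right _ _
      rw [he₀] at this; linarith
    set K : ℝ := 1 + univ.sup' univ_nonempty (fun x => |D x|) with hK
    have hDK : ∀ x, |D x| ≤ K := fun x => by
      have := le_sup' (fun x => |D x|) (mem_univ x)
      rw [hK]; linarith
    have hKpos : 0 < K := by
      have := (abs_nonneg (D z₀)).trans (le_sup' (fun x => |D x|) (mem_univ z₀))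
      rw [hK]; linarith
    -- the constant
    set C : ℝ := (c * ε / (d₀ * (m : ℝ) ^ 2 * K)) ^ ((d₀ : ℝ) / 4) * (ε / K) ^ ((3 : ℝ) / 2) *
      Real.sqrt (cubeExpect f₁) with hC
    have hbase : 0 < c * ε / (d₀ * (m : ℝ) ^ 2 * K) := by
      have : (0 : ℝ) < d₀ := by exact_mod_cast hd₀1
      have : (0 : ℝ) < m := by exact_mod_cast hm
      positivity
    have hCpos : 0 < C := by
      rw [hC]
      refine mul_pos (mul_pos (Real.rpow_pos_of_pos hbase _) (Real.rpow_pos_of_pos (by positivity) _)) ?_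
      exact Real.sqrt_pos.2 hEf₁
    refine ⟨C, hCpos, fun n hn d hd => ⟨hupper n d hd, fun r hr hfac => ?_⟩⟩
    have hdd : d = d₀ := hd_unique d hd
    subst hdd
    have hn2 : (2 : ℝ) ≤ n := by exact_mod_cast (show 2 ≤ n by omega)
    have hlog : 0 < Real.log n := Real.log_pos (by linarith)
    have hnl : 0 ≤ (n : ℝ) / Real.log n := div_nonneg (by positivity) hlog.le
    refine h38 m (sosDegree f - 2) hm hd₀1 f₁ hf₁01 ε hεpos hε1 D K hD hDK hDf n hn r ?_
      (htransfer n r hfac)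
    -- our bound `C (n/log n)^{d/4}` is Theorem 3.8's bound
    have hsplit : c * ε * n / ((sosDegree f - 2 : ℕ) * (m : ℝ) ^ 2 * K * Real.log n) =
        (c * ε / ((sosDegree f - 2 : ℕ) * (m : ℝ) ^ 2 * K)) * ((n : ℝ) / Real.log n) := by
      rw [div_mul_div_comm]
    rw [hsplit, Real.mul_rpow hbase.le hnl]
    calc (r : ℝ) < C * ((n : ℝ) / Real.log n) ^ (((sosDegree f - 2 : ℕ) : ℝ) / 4) := hr
      _ = _ := by rw [hC]; ring

end Literature.Combinatorics.Optimization

end
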